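import Summits.ValiantsHypothesis.ValiantsHypothesis.Theorems.KPlusLogSqLawTropicalBMarkedEdgeCoreKOneJ
import Summits.ValiantsHypothesis.ValiantsHypothesis.Theorems.KPlusLogSqLawTropicalBMarkedEdgeCoreZPairs

/-!
# Route «KPlusLogSqLaw», crux `TropicalB` (stmt-ValiantsHypothesis-19771) — MARKED-EDGE sector, NESTED-TRIANGLE CORE, ALL sizes:
# the REGIME SPLIT — a mark cannot be both unreachable from `b0` and unable to return to `b0`

HONEST FRAMING.  Helper file (cell `pub-symmetroid`, seat val-sym-trop-p4 (g21), 2026-08-29; `--supports stmt-ValiantsHypothesis-19771 --as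
helper`).  First kernel step of the (located) REGIME THEOREM K2 of this seat's memo HOME/val-sym-trop-p4/g21/RIGIDITY-g21.md §3/§6: by
`core_BCZ_four` (reachability form `core_noWalkBC`) each of the marks `q = b2`, `r = b3` of the pair (B,C) satisfies «`q` unreachable from `b0`»
OR «`σZ⁻¹ q` cannot reach `b0`»; THIS FILE shows the two alternatives EXCLUDE each other as soon as the pair has a Q-cover through `p = b1`
(`p` reachable from `b0` and `σZ⁻¹ p` reaching `b0`): otherwise the relative cover `σZ⁻¹σB` would carry a split `b4`-cycle inside
«unreachable ∪ non-returning» which by `core_BZ_structure` contains `b1` (`core_regimeSplit_two`).  Hence exactly the four regimes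
(U,U) = Regime I, (D,D) = Regime II, (U,D), (D,U) remain.  Nothing here proves the nested-triangle law; nothing concerns `TropicalB` in its
window, `WeakLifting`, the doors, `MatrixDescartes` (stmt-ValiantsHypothesis-18050) or VP ≠ VNP.
-/

set_option linter.dupNamespace false
set_option autoImplicit false

namespace Summit.ValiantsHypothesis.ValiantsHypothesis.Theorems.KPlusLogSqLaw
namespace MarkedEdge
namespace Core

open Finset

variable {V : Type*} [Fintype V] [DecidableEq V]

/-- **Forward orbit.**  If `D` (a set of non-gate nodes) is closed under `x`-successors up to the gate `s` and `v ∈ D` is moved by `x`, then the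
`x`-chain from `v` reaches `s`: `xʲ v = s` for some `j ≥ 1` with `xⁱ v ∈ D` for `i < j`.  (`backward_orbit` for `x⁻¹` and the reversed
height.) [this seat's lemma] -/
theorem forward_orbit (x : Equiv.Perm V) (s t : V) (h : V → ℕ)
    (hx : ∀ i, i ≠ s → i ≠ t → x i ≠ s → x i ≠ t → x i ≠ i → h i < h (x i))
    (D : Finset V) (hsD : s ∉ D) (htD : t ∉ D) (hDx : ∀ i, i ∈ D → x i ≠ i → x i ∈ D ∨ x i = s)
    (v : V) (hv : v ∈ D) (hxv : x v ≠ v) :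
    ∃ j : ℕ, 1 ≤ j ∧ (x ^ j) v = s ∧ ∀ i, i < j → (x ^ i) v ∈ D := by
  -- reversed height
  set M : ℕ := Finset.univ.sup h with hM
  have hle : ∀ i, h i ≤ M := fun i => Finset.le_sup (f := h) (Finset.mem_univ i)
  have hx' : ∀ i, i ≠ s → i ≠ t → x⁻¹ i ≠ s → x⁻¹ i ≠ t → x⁻¹ i ≠ i → (M - h i) < (M - h (x⁻¹ i)) := by
    intro i h1 h2 h3 h4 h5
    have := hx (x⁻¹ i) h3 h4 (by simpa using h1) (by simpa using h2) (by
      intro h'; apply h5; have e : x (x⁻¹ i) = i := by simp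
      rw [e] at h'; exact h'.symm)
    have e : x (x⁻¹ i) = i := by simp
    rw [e] at this
    have := hle i; have := hle (x⁻¹ i); omega
  have hUx' : ∀ i, x⁻¹ i ∈ D → x⁻¹ i ≠ i → i ∈ D ∨ i = s := by
    intro i hi hmov
    have hm : x (x⁻¹ i) ≠ x⁻¹ i := by
      intro h'; apply hmov
      have : x (x⁻¹ i) = i := by simp
      rw [this] at h'; exact h'.symm
    rcases hDx (x⁻¹ i) hi hm with h' | h'
    · left; simpa using h'
    · right; simpa using h'
  have hmov' : x⁻¹ v ≠ v := fun h' => hxv (Equiv.Perm.inv_eq_iff_eq.mp h').symm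
  obtain ⟨j, hj1, hjv, hjD⟩ := backward_orbit x⁻¹ s t (fun i => M - h i) hx' D hsD htD hUx' (M - h v) v le_rfl hv hmov'
  refine ⟨j, hj1, ?_, fun i hi => ?_⟩
  · have : (x ^ j)⁻¹ s = v := by rw [← inv_pow]; exact hjv
    rw [Equiv.Perm.inv_eq_iff_eq] at this
    exact this.symm
  · -- (x^i) v = (x⁻¹)^(j-i) s
    have e : (x ^ i) v = (x⁻¹ ^ (j - i)) s := by
      have h1 : v = (x⁻¹ ^ j) s := hjv.symm
      rw [h1, ← Equiv.Perm.mul_apply]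
      congr 1
      rw [show x⁻¹ ^ j = x⁻¹ ^ i * x⁻¹ ^ (j - i) by rw [← pow_add, show i + (j - i) = j by omega], ← mul_assoc,
        inv_pow x i, mul_inv_cancel, one_mul]
    rw [e]; exact hjD (j - i) (by omega) (by omega)

omit [Fintype V] [DecidableEq V] in
/-- **Successor closure of the non-returning set.**  For the down-walk relation `R i j := i ≠ s ∧ i ≠ t ∧ j ≠ s ∧ i ≠ j ∧ A i j`: if `v` is a
non-gate node that cannot reach `t` and `c v ≠ v` is an `A`-arc, then `c v` cannot reach `t` either (and is not `t`), unless `c v = s`.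
[folklore] -/
theorem nonret_succ (A : V → V → Prop) (c : V → V) (s t : V) (hA : ∀ i, c i ≠ i → A i (c i)) (v : V)
    (hv : v ≠ s ∧ v ≠ t ∧ ¬ Relation.TransGen (fun i j => i ≠ s ∧ i ≠ t ∧ j ≠ s ∧ i ≠ j ∧ A i j) v t) (hmov : c v ≠ v) :
    (c v ≠ s ∧ c v ≠ t ∧ ¬ Relation.TransGen (fun i j => i ≠ s ∧ i ≠ t ∧ j ≠ s ∧ i ≠ j ∧ A i j) (c v) t) ∨ c v = s := by
  by_cases hcs : c v = s
  · exact Or.inr hcs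
  · refine Or.inl ⟨hcs, fun hct => ?_, fun hreach => ?_⟩
    · have h1 : Relation.TransGen (fun i j => i ≠ s ∧ i ≠ t ∧ j ≠ s ∧ i ≠ j ∧ A i j) v (c v) :=
        Relation.TransGen.single ⟨hv.1, hv.2.1, hcs, fun h' => hmov h'.symm, hA v hmov⟩
      rw [hct] at h1
      exact hv.2.2 h1
    · exact hv.2.2 (Relation.TransGen.head ⟨hv.1, hv.2.1, hcs, fun h' => hmov h'.symm, hA v hmov⟩ hreach)

omit [Fintype V] [DecidableEq V] in
/-- Periodicity of iterates at a point: if `xᴺ s = s` then `xⁱ s = x^(i % N) s`. [folklore] -/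
theorem pow_apply_mod (x : Equiv.Perm V) (s : V) (N : ℕ) (hN : (x ^ N) s = s) (i : ℕ) : (x ^ i) s = (x ^ (i % N)) s := by
  conv_lhs => rw [← Nat.mod_add_div i N, pow_add, pow_mul]
  rw [Equiv.Perm.mul_apply]
  congr 1
  induction i / N with
  | zero => simp
  | succ k ih => rw [pow_succ, Equiv.Perm.mul_apply, hN, ih]


section Core

variable (ok : V → V → Prop) (w g : V → V → ℤ) (b : Fin 5 → V)

/-- **REGIME SPLIT at `b2` (pair (B,C)).**  In a realisation of the nested-triangle core, if `b1` is reachable from `b0` by a rising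
`σB/σC`-walk and `σZ⁻¹ b1` reaches `b0` by one (the two halves of a Q₁₈-cover), then it is impossible that `b2` is unreachable from `b0` AND
`σZ⁻¹ b2` cannot reach `b0` (rising `σB/σC`-walks).  Proof: the `σZ⁻¹σB`-chain through `b2` would be a closed `b4`-cycle inside
«unreachable» ∪ «non-returning»; by `core_BZ_structure` that cycle carries `b1`. [this seat's theorem — memo §6 (1)] -/
theorem core_regimeSplit_two (hb : Function.Injective b)
    (hoff : ∀ i j, j ≠ i → g i j = 0) (hmark : ∀ l, g (b l) (b l) = (2 : ℤ) ^ (l : ℕ)) (haux : ∀ i, (∀ l, b l ≠ i) → g i i = 0)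
    {θB θC θE θZ : ℤ} {σB σC σE σZ : Equiv.Perm V} (hBC : θB < θC) (hCE : θC < θE) (hEZ : θE < θZ)
    (hB : (∀ i, ok i (σB i)) ∧ ∀ τ : Equiv.Perm V, τ ≠ σB → (∀ i, ok i (τ i)) →
      ∑ i, (w i (τ i) + θB * g i (τ i)) < ∑ i, (w i (σB i) + θB * g i (σB i)))
    (hC : (∀ i, ok i (σC i)) ∧ ∀ τ : Equiv.Perm V, τ ≠ σC → (∀ i, ok i (τ i)) →
      ∑ i, (w i (τ i) + θC * g i (τ i)) < ∑ i, (w i (σC i) + θC * g i (σC i)))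
    (hE : (∀ i, ok i (σE i)) ∧ ∀ τ : Equiv.Perm V, τ ≠ σE → (∀ i, ok i (τ i)) →
      ∑ i, (w i (τ i) + θE * g i (τ i)) < ∑ i, (w i (σE i) + θE * g i (σE i)))
    (hZ : (∀ i, ok i (σZ i)) ∧ ∀ τ : Equiv.Perm V, τ ≠ σZ → (∀ i, ok i (τ i)) →
      ∑ i, (w i (τ i) + θZ * g i (τ i)) < ∑ i, (w i (σZ i) + θZ * g i (σZ i)))
    (hB0 : σB (b 0) ≠ b 0) (hB1 : σB (b 1) = b 1) (hB2 : σB (b 2) = b 2) (hB3 : σB (b 3) ≠ b 3) (hB4 : σB (b 4) ≠ b 4)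
    (hC0 : σC (b 0) ≠ b 0) (hC1 : σC (b 1) = b 1) (hC2 : σC (b 2) ≠ b 2) (hC3 : σC (b 3) = b 3) (hC4 : σC (b 4) ≠ b 4)
    (hE0 : σE (b 0) ≠ b 0) (hE1 : σE (b 1) ≠ b 1) (hE2 : σE (b 2) = b 2) (hE3 : σE (b 3) = b 3) (hE4 : σE (b 4) ≠ b 4)
    (hZ0 : σZ (b 0) = b 0) (hZ1 : σZ (b 1) ≠ b 1) (hZ2 : σZ (b 2) ≠ b 2) (hZ3 : σZ (b 3) ≠ b 3) (hZ4 : σZ (b 4) = b 4)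
    (hpF : Relation.TransGen (fun i j => i ≠ b 4 ∧ j ≠ b 4 ∧ j ≠ b 0 ∧ i ≠ j ∧ (σZ j = σB i ∨ σZ j = σC i)) (b 0) (b 1))
    (hpB : Relation.TransGen (fun i j => i ≠ b 4 ∧ i ≠ b 0 ∧ j ≠ b 4 ∧ i ≠ j ∧ (σZ j = σB i ∨ σZ j = σC i)) (σZ⁻¹ (b 1)) (b 0))
    (hqU : ¬ Relation.TransGen (fun i j => i ≠ b 4 ∧ j ≠ b 4 ∧ j ≠ b 0 ∧ i ≠ j ∧ (σZ j = σB i ∨ σZ j = σC i)) (b 0) (b 2))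
    (hqD : ¬ Relation.TransGen (fun i j => i ≠ b 4 ∧ i ≠ b 0 ∧ j ≠ b 4 ∧ i ≠ j ∧ (σZ j = σB i ∨ σZ j = σC i)) (σZ⁻¹ (b 2)) (b 0)) :
    False := by
  classical
  set s := b 4 with hs
  set t := b 0 with ht
  set x : Equiv.Perm V := σZ⁻¹ * σB with hxdef
  have hxa : ∀ i, σZ (x i) = σB i := fun i => by simp [hxdef]
  have hb10 : b 1 ≠ b 0 := fun h' => by have := hb h'; simp at this
  have hb14 : b 1 ≠ b 4 := fun h' => by have := hb h'; simp at this
  have hb20 : b 2 ≠ b 0 := fun h' => by have := hb h'; simp at this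
  have hb24 : b 2 ≠ b 4 := fun h' => by have := hb h'; simp at this
  have hxq : x (b 2) = σZ⁻¹ (b 2) := by apply σZ.injective; simp [hxdef, hB2]
  have hxp : x (b 1) = σZ⁻¹ (b 1) := by apply σZ.injective; simp [hxdef, hB1]
  have hq'ne : σZ⁻¹ (b 2) ≠ b 2 := fun h' => hZ2 (by have := congrArg σZ h'; simpa using this.symm)
  have hp'ne : σZ⁻¹ (b 1) ≠ b 1 := fun h' => hZ1 (by have := congrArg σZ h'; simpa using this.symm)
  have hq'0 : σZ⁻¹ (b 2) ≠ t := fun h' => hb20 (by rw [Equiv.Perm.inv_eq_iff_eq, hZ0] at h'; exact h')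
  have hq'4 : σZ⁻¹ (b 2) ≠ s := fun h' => hb24 (by rw [Equiv.Perm.inv_eq_iff_eq, hZ4] at h'; exact h')
  have hxq_mov : x (b 2) ≠ b 2 := by rw [hxq]; exact hq'ne
  -- heights
  obtain ⟨h, hh⟩ := core_exists_height ok w g b hb hoff hmark haux hBC hCE hEZ hB hC hE hZ hB0 hB1 hB2 hB3 hB4 hC0 hC1 hC2 hC3 hC4
    hE0 hE1 hE2 hE3 hE4 hZ0 hZ1 hZ2 hZ3 hZ4
  have hxh : ∀ i, i ≠ s → i ≠ t → x i ≠ s → x i ≠ t → x i ≠ i → h i < h (x i) :=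
    fun i h1 h2 h3 h4 h5 => hh i (x i) h2 h1 h4 h3 (Ne.symm h5) (Or.inl (hxa i))
  -- the two sets
  let A : V → V → Prop := fun i j => σZ j = σB i ∨ σZ j = σC i
  let PU : V → Prop := fun v => v ≠ s ∧ v ≠ t ∧ ¬ Relation.TransGen (fun i j => i ≠ s ∧ j ≠ s ∧ j ≠ t ∧ i ≠ j ∧ A i j) t v
  let PD : V → Prop := fun v => v ≠ s ∧ v ≠ t ∧ ¬ Relation.TransGen (fun i j => i ≠ s ∧ i ≠ t ∧ j ≠ s ∧ i ≠ j ∧ A i j) v t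
  set U : Finset V := Finset.univ.filter PU with hU
  set D : Finset V := Finset.univ.filter PD with hD
  have memU : ∀ v, v ∈ U ↔ PU v := fun v => by simp [hU]
  have memD : ∀ v, v ∈ D ↔ PD v := fun v => by simp [hD]
  have hsU : s ∉ U := fun h' => ((memU s).mp h').1 rfl
  have htU : t ∉ U := fun h' => ((memU t).mp h').2.1 rfl
  have hsD : s ∉ D := fun h' => ((memD s).mp h').1 rfl
  have htD : t ∉ D := fun h' => ((memD t).mp h').2.1 rfl
  have hUx : ∀ i, x i ∈ U → x i ≠ i → i ∈ U ∨ i = s := by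
    intro i hi hmov
    rcases unreach_pred A x s t (fun j _ => Or.inl (hxa j)) i ((memU _).mp hi) hmov with h' | h'
    · exact Or.inl ((memU i).mpr h')
    · exact Or.inr h'
  have hDx : ∀ i, i ∈ D → x i ≠ i → x i ∈ D ∨ x i = s := by
    intro i hi hmov
    rcases nonret_succ A x s t (fun j _ => Or.inl (hxa j)) i ((memD _).mp hi) hmov with h' | h'
    · exact Or.inl ((memD _).mpr h')
    · exact Or.inr h'
  -- q ∈ U, q⁺ ∈ D
  have hqU' : b 2 ∈ U := (memU _).mpr ⟨hb24, hb20, hqU⟩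
  have hqD' : x (b 2) ∈ D := by rw [hxq]; exact (memD _).mpr ⟨hq'4, hq'0, hqD⟩
  -- the s-prefix to q and the forward chain from q⁺ to s
  obtain ⟨n, hn, hnq, hnU⟩ := backward_orbit x s t h hxh U hsU htU hUx (h (b 2)) (b 2) le_rfl hqU' hxq_mov
  obtain ⟨j, hj, hjs, hjD⟩ := forward_orbit x s t h hxh D hsD htD hDx (x (b 2)) hqD' (fun h' => hxq_mov (x.injective h'))
  -- the closed s-cycle: x^N s = s with N = n + 1 + j, and every node on it is s, in U, or in D
  set N := n + 1 + j with hNdef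
  have hN : (x ^ N) s = s := by
    rw [hNdef, show n + 1 + j = j + (1 + n) by omega, pow_add, Equiv.Perm.mul_apply, pow_add, Equiv.Perm.mul_apply, hnq, pow_one, hjs]
  have honcycle : ∀ k, k < N → k = 0 ∨ (x ^ k) s ∈ U ∨ (x ^ k) s ∈ D := by
    intro k hk
    rcases Nat.eq_zero_or_pos k with h0 | hpos
    · exact Or.inl h0
    · by_cases hkn : k ≤ n
      · exact Or.inr (Or.inl (hnU k hpos hkn))
      · right; right
        have e : (x ^ k) s = (x ^ (k - n - 1)) (x (b 2)) := by
          rw [← hnq, ← pow_succ_apply x n s, ← Equiv.Perm.mul_apply, ← pow_add, show k - n - 1 + (n + 1) = k by omega]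
        rw [e]; exact hjD (k - n - 1) (by omega)
  -- b1 lies on this cycle (core_BZ_structure), at some position k < N
  have hxinv : σB⁻¹ * σZ = x⁻¹ := by simp [hxdef]
  have hst := core_BZ_structure ok w g b hb hoff hmark haux (hBC.trans (hCE.trans hEZ)) hB hZ hB0 hB1 hB2 hB3 hB4 hZ0 hZ1 hZ2 hZ3 hZ4
    (b 2) (by rw [hxinv]; intro h'; apply hxq_mov; have := congrArg x h'; simpa using this.symm)
  rw [hxinv] at hst
  simp only [Equiv.Perm.sameCycle_inv] at hst
  have hsame_qs : x.SameCycle (b 2) s := ⟨((j + 1 : ℕ) : ℤ), by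
    rw [zpow_natCast, pow_add, Equiv.Perm.mul_apply, pow_one, hjs]⟩
  rcases hst with ⟨-, h1, -⟩ | ⟨-, -, -, h4⟩
  · -- p on the cycle of q, hence of s
    have hsp : x.SameCycle s (b 1) := hsame_qs.symm.trans h1
    obtain ⟨i, hi⟩ := hsp.exists_nat_pow_eq
    rw [pow_apply_mod x s N hN i] at hi
    have hlt : i % N < N := Nat.mod_lt _ (by omega)
    rcases honcycle (i % N) hlt with h0 | hUp | hDp
    · rw [h0, pow_zero, Equiv.Perm.one_apply] at hi; exact hb14 hi.symm
    · rw [hi] at hUp; exact ((memU _).mp hUp).2.2 hpF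
    · rw [hi] at hDp
      refine ((memD _).mp hDp).2.2 (Relation.TransGen.head ⟨hb14, hb10, ?_, fun h' => hp'ne h'.symm, ?_⟩ hpB)
      · exact fun h' => hb14 (by have := congrArg σZ h'; simpa [hZ4] using this)
      · left; simp [hB1]
  · exact h4 hsame_qs

/-- **REGIME SPLIT at `b3` (pair (B,C)).**  The same for the mark `b3` and the relative cover `σZ⁻¹σC` (`core_CZ_structure`): with a
Q₁₈-cover present, `b3` cannot be unreachable from `b0` while `σZ⁻¹ b3` cannot reach `b0`. [this seat's theorem — memo §6 (1)] -/
theorem core_regimeSplit_three (hb : Function.Injective b)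
    (hoff : ∀ i j, j ≠ i → g i j = 0) (hmark : ∀ l, g (b l) (b l) = (2 : ℤ) ^ (l : ℕ)) (haux : ∀ i, (∀ l, b l ≠ i) → g i i = 0)
    {θB θC θE θZ : ℤ} {σB σC σE σZ : Equiv.Perm V} (hBC : θB < θC) (hCE : θC < θE) (hEZ : θE < θZ)
    (hB : (∀ i, ok i (σB i)) ∧ ∀ τ : Equiv.Perm V, τ ≠ σB → (∀ i, ok i (τ i)) →
      ∑ i, (w i (τ i) + θB * g i (τ i)) < ∑ i, (w i (σB i) + θB * g i (σB i)))
    (hC : (∀ i, ok i (σC i)) ∧ ∀ τ : Equiv.Perm V, τ ≠ σC → (∀ i, ok i (τ i)) →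
      ∑ i, (w i (τ i) + θC * g i (τ i)) < ∑ i, (w i (σC i) + θC * g i (σC i)))
    (hE : (∀ i, ok i (σE i)) ∧ ∀ τ : Equiv.Perm V, τ ≠ σE → (∀ i, ok i (τ i)) →
      ∑ i, (w i (τ i) + θE * g i (τ i)) < ∑ i, (w i (σE i) + θE * g i (σE i)))
    (hZ : (∀ i, ok i (σZ i)) ∧ ∀ τ : Equiv.Perm V, τ ≠ σZ → (∀ i, ok i (τ i)) →
      ∑ i, (w i (τ i) + θZ * g i (τ i)) < ∑ i, (w i (σZ i) + θZ * g i (σZ i)))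
    (hB0 : σB (b 0) ≠ b 0) (hB1 : σB (b 1) = b 1) (hB2 : σB (b 2) = b 2) (hB3 : σB (b 3) ≠ b 3) (hB4 : σB (b 4) ≠ b 4)
    (hC0 : σC (b 0) ≠ b 0) (hC1 : σC (b 1) = b 1) (hC2 : σC (b 2) ≠ b 2) (hC3 : σC (b 3) = b 3) (hC4 : σC (b 4) ≠ b 4)
    (hE0 : σE (b 0) ≠ b 0) (hE1 : σE (b 1) ≠ b 1) (hE2 : σE (b 2) = b 2) (hE3 : σE (b 3) = b 3) (hE4 : σE (b 4) ≠ b 4)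
    (hZ0 : σZ (b 0) = b 0) (hZ1 : σZ (b 1) ≠ b 1) (hZ2 : σZ (b 2) ≠ b 2) (hZ3 : σZ (b 3) ≠ b 3) (hZ4 : σZ (b 4) = b 4)
    (hpF : Relation.TransGen (fun i j => i ≠ b 4 ∧ j ≠ b 4 ∧ j ≠ b 0 ∧ i ≠ j ∧ (σZ j = σB i ∨ σZ j = σC i)) (b 0) (b 1))
    (hpB : Relation.TransGen (fun i j => i ≠ b 4 ∧ i ≠ b 0 ∧ j ≠ b 4 ∧ i ≠ j ∧ (σZ j = σB i ∨ σZ j = σC i)) (σZ⁻¹ (b 1)) (b 0))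
    (hqU : ¬ Relation.TransGen (fun i j => i ≠ b 4 ∧ j ≠ b 4 ∧ j ≠ b 0 ∧ i ≠ j ∧ (σZ j = σB i ∨ σZ j = σC i)) (b 0) (b 3))
    (hqD : ¬ Relation.TransGen (fun i j => i ≠ b 4 ∧ i ≠ b 0 ∧ j ≠ b 4 ∧ i ≠ j ∧ (σZ j = σB i ∨ σZ j = σC i)) (σZ⁻¹ (b 3)) (b 0)) :
    False := by
  classical
  set s := b 4 with hs
  set t := b 0 with ht
  set x : Equiv.Perm V := σZ⁻¹ * σC with hxdef
  have hxa : ∀ i, σZ (x i) = σC i := fun i => by simp [hxdef]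
  have hb10 : b 1 ≠ b 0 := fun h' => by have := hb h'; simp at this
  have hb14 : b 1 ≠ b 4 := fun h' => by have := hb h'; simp at this
  have hb20 : b 3 ≠ b 0 := fun h' => by have := hb h'; simp at this
  have hb24 : b 3 ≠ b 4 := fun h' => by have := hb h'; simp at this
  have hxq : x (b 3) = σZ⁻¹ (b 3) := by apply σZ.injective; simp [hxdef, hC3]
  have hxp : x (b 1) = σZ⁻¹ (b 1) := by apply σZ.injective; simp [hxdef, hC1]
  have hq'ne : σZ⁻¹ (b 3) ≠ b 3 := fun h' => hZ3 (by have := congrArg σZ h'; simpa using this.symm)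
  have hp'ne : σZ⁻¹ (b 1) ≠ b 1 := fun h' => hZ1 (by have := congrArg σZ h'; simpa using this.symm)
  have hq'0 : σZ⁻¹ (b 3) ≠ t := fun h' => hb20 (by rw [Equiv.Perm.inv_eq_iff_eq, hZ0] at h'; exact h')
  have hq'4 : σZ⁻¹ (b 3) ≠ s := fun h' => hb24 (by rw [Equiv.Perm.inv_eq_iff_eq, hZ4] at h'; exact h')
  have hxq_mov : x (b 3) ≠ b 3 := by rw [hxq]; exact hq'ne
  -- heights
  obtain ⟨h, hh⟩ := core_exists_height ok w g b hb hoff hmark haux hBC hCE hEZ hB hC hE hZ hB0 hB1 hB2 hB3 hB4 hC0 hC1 hC2 hC3 hC4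
    hE0 hE1 hE2 hE3 hE4 hZ0 hZ1 hZ2 hZ3 hZ4
  have hxh : ∀ i, i ≠ s → i ≠ t → x i ≠ s → x i ≠ t → x i ≠ i → h i < h (x i) :=
    fun i h1 h2 h3 h4 h5 => hh i (x i) h2 h1 h4 h3 (Ne.symm h5) (Or.inr (Or.inl (hxa i)))
  -- the two sets
  let A : V → V → Prop := fun i j => σZ j = σB i ∨ σZ j = σC i
  let PU : V → Prop := fun v => v ≠ s ∧ v ≠ t ∧ ¬ Relation.TransGen (fun i j => i ≠ s ∧ j ≠ s ∧ j ≠ t ∧ i ≠ j ∧ A i j) t v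
  let PD : V → Prop := fun v => v ≠ s ∧ v ≠ t ∧ ¬ Relation.TransGen (fun i j => i ≠ s ∧ i ≠ t ∧ j ≠ s ∧ i ≠ j ∧ A i j) v t
  set U : Finset V := Finset.univ.filter PU with hU
  set D : Finset V := Finset.univ.filter PD with hD
  have memU : ∀ v, v ∈ U ↔ PU v := fun v => by simp [hU]
  have memD : ∀ v, v ∈ D ↔ PD v := fun v => by simp [hD]
  have hsU : s ∉ U := fun h' => ((memU s).mp h').1 rfl
  have htU : t ∉ U := fun h' => ((memU t).mp h').2.1 rfl
  have hsD : s ∉ D := fun h' => ((memD s).mp h').1 rfl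
  have htD : t ∉ D := fun h' => ((memD t).mp h').2.1 rfl
  have hUx : ∀ i, x i ∈ U → x i ≠ i → i ∈ U ∨ i = s := by
    intro i hi hmov
    rcases unreach_pred A x s t (fun j _ => Or.inr (hxa j)) i ((memU _).mp hi) hmov with h' | h'
    · exact Or.inl ((memU i).mpr h')
    · exact Or.inr h'
  have hDx : ∀ i, i ∈ D → x i ≠ i → x i ∈ D ∨ x i = s := by
    intro i hi hmov
    rcases nonret_succ A x s t (fun j _ => Or.inr (hxa j)) i ((memD _).mp hi) hmov with h' | h'
    · exact Or.inl ((memD _).mpr h')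
    · exact Or.inr h'
  -- q ∈ U, q⁺ ∈ D
  have hqU' : b 3 ∈ U := (memU _).mpr ⟨hb24, hb20, hqU⟩
  have hqD' : x (b 3) ∈ D := by rw [hxq]; exact (memD _).mpr ⟨hq'4, hq'0, hqD⟩
  -- the s-prefix to q and the forward chain from q⁺ to s
  obtain ⟨n, hn, hnq, hnU⟩ := backward_orbit x s t h hxh U hsU htU hUx (h (b 3)) (b 3) le_rfl hqU' hxq_mov
  obtain ⟨j, hj, hjs, hjD⟩ := forward_orbit x s t h hxh D hsD htD hDx (x (b 3)) hqD' (fun h' => hxq_mov (x.injective h'))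
  -- the closed s-cycle: x^N s = s with N = n + 1 + j, and every node on it is s, in U, or in D
  set N := n + 1 + j with hNdef
  have hN : (x ^ N) s = s := by
    rw [hNdef, show n + 1 + j = j + (1 + n) by omega, pow_add, Equiv.Perm.mul_apply, pow_add, Equiv.Perm.mul_apply, hnq, pow_one, hjs]
  have honcycle : ∀ k, k < N → k = 0 ∨ (x ^ k) s ∈ U ∨ (x ^ k) s ∈ D := by
    intro k hk
    rcases Nat.eq_zero_or_pos k with h0 | hpos
    · exact Or.inl h0
    · by_cases hkn : k ≤ n
      · exact Or.inr (Or.inl (hnU k hpos hkn))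
      · right; right
        have e : (x ^ k) s = (x ^ (k - n - 1)) (x (b 3)) := by
          rw [← hnq, ← pow_succ_apply x n s, ← Equiv.Perm.mul_apply, ← pow_add, show k - n - 1 + (n + 1) = k by omega]
        rw [e]; exact hjD (k - n - 1) (by omega)
  -- b1 lies on this cycle (core_BZ_structure), at some position k < N
  have hxinv : σC⁻¹ * σZ = x⁻¹ := by simp [hxdef]
  have hst := core_CZ_structure ok w g b hb hoff hmark haux (hCE.trans hEZ) hC hZ hC0 hC1 hC2 hC3 hC4 hZ0 hZ1 hZ2 hZ3 hZ4
    (b 3) (by rw [hxinv]; intro h'; apply hxq_mov; have := congrArg x h'; simpa using this.symm)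
  rw [hxinv] at hst
  simp only [Equiv.Perm.sameCycle_inv] at hst
  have hsame_qs : x.SameCycle (b 3) s := ⟨((j + 1 : ℕ) : ℤ), by
    rw [zpow_natCast, pow_add, Equiv.Perm.mul_apply, pow_one, hjs]⟩
  rcases hst with ⟨-, h1, -⟩ | ⟨-, -, -, h4⟩
  · -- p on the cycle of q, hence of s
    have hsp : x.SameCycle s (b 1) := hsame_qs.symm.trans h1
    obtain ⟨i, hi⟩ := hsp.exists_nat_pow_eq
    rw [pow_apply_mod x s N hN i] at hi
    have hlt : i % N < N := Nat.mod_lt _ (by omega)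
    rcases honcycle (i % N) hlt with h0 | hUp | hDp
    · rw [h0, pow_zero, Equiv.Perm.one_apply] at hi; exact hb14 hi.symm
    · rw [hi] at hUp; exact ((memU _).mp hUp).2.2 hpF
    · rw [hi] at hDp
      refine ((memD _).mp hDp).2.2 (Relation.TransGen.head ⟨hb14, hb10, ?_, fun h' => hp'ne h'.symm, ?_⟩ hpB)
      · exact fun h' => hb14 (by have := congrArg σZ h'; simpa [hZ4] using this)
      · right; simp [hC1]
  · exact h4 hsame_qs

end Core

end Core
end MarkedEdge
end Summit.ValiantsHypothesis.ValiantsHypothesis.Theorems.KPlusLogSqLaw
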